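import Summits.RiemannHypothesis.RiemannHypothesis.Theorems.MotivicDoorFunctionFieldHonest
import Summits.RiemannHypothesis.RiemannHypothesis.Theorems.MotivicDoorFfDialDensity

/-!
# FE ⟺ `c₀ = q^g` for RH-true data (FF-DOOR part 3b; cell `pub-rhdoor`, seat ff-2)

For an RH-true monic `h ∈ ℤ[X]` of degree `2g` over `q`, the coefficient functional equation holds iff
`c₀ = q^g` — the (ii).C.2 mechanism of FF-DOOR.md, typed: RH makes the root multiset `q`-reciprocal
(`frobRoots_map_div_of_rh`, part 3), and ff-1's tight dictionary `fe_iff_map_reciprocal_and_coeff_zero`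
(part 4, `MotivicDoorFfDialDensity`) converts reciprocity + `c₀ = q^g` into the FE.  Consequence: a datum
geometric up to a power is honest as soon as `c₀ = q^g` (for genuine Frobenius data `c₀ = deg π_A = q^g`;
the RH-true non-honest `X² − q` has `c₀ = −q`).  HONEST FRAMING: function-field mirror only; nothing about ζ.
-/

set_option linter.dupNamespace false

open Polynomial
open scoped ComplexOrder

namespace Summit.RiemannHypothesis.RiemannHypothesis.Theorems.MotivicDoor.FunctionField

open Literature.AlgebraicGeometry.Motives
open Summit.RiemannHypothesis.RiemannHypothesis.Theorems.PfPersistence.FfAngleTwin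

universe u

/-- RH ⇒ `q`-reciprocity, `ℕ`-spelled (`(q : ℂ) / α` with `q : ℕ`, the spelling of ff-1's dictionary). [PROVED] -/
theorem frobRoots_map_natCast_div_of_rh {q : ℕ} {h : ℤ[X]}
    (hRH : ∀ α ∈ frobRoots h, ‖α‖ = Real.sqrt q) :
    (frobRoots h).map (fun α => (q : ℂ) / α) = frobRoots h := by
  have := frobRoots_map_div_of_rh (Nat.cast_nonneg q) hRH
  simpa only [Complex.ofReal_natCast] using this

/-- **FE ⟺ `c₀ = q^g`, for RH-true monic `h` of degree `2g`** (`q > 0`). [PROVED] -/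
theorem fe_iff_coeff_zero_of_rh {q : ℕ} (hq : 0 < q) {h : ℤ[X]} {g : ℕ} (hh : h.Monic)
    (hdeg : h.natDegree = 2 * g) (hRH : ∀ α ∈ frobRoots h, ‖α‖ = Real.sqrt q) :
    (∀ i j, i + j = 2 * g → (q : ℤ) ^ g * h.coeff j = (q : ℤ) ^ i * h.coeff i) ↔
      h.coeff 0 = (q : ℤ) ^ g :=
  ⟨coeff_zero_eq_of_fe hq hh hdeg, fun hc0 =>
    (fe_iff_map_reciprocal_and_coeff_zero hq hh hdeg).2 ⟨frobRoots_map_natCast_div_of_rh hRH, hc0⟩⟩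

variable {K : Type u} [Field K] [Finite K]

omit [Finite K] in
/-- `q = #K` is a prime power: the door theorems range over ALL prime powers `q` and never single out primes
(REFEREE-1 C3 (i) / C6: no separate binder `q = p^a` is needed). [PROVED, Mathlib `FiniteField.isPrimePow_card`] -/
theorem isPrimePow_natCard [Finite K] : IsPrimePow (Nat.card K) := by
  haveI := Fintype.ofFinite K
  rw [Nat.card_eq_fintype_card]
  exact FiniteField.isPrimePow_card K

/-- **Geometric up to a power and `c₀ = q^g` ⇒ honest.**  If some power of a monic `h` of degree `2g` is
the characteristic polynomial of a Frobenius over `K` and `h(0) = (#K)^g`, then `h` satisfies the coefficient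
functional equation. [PROVED from `weilRiemannHypothesis`] -/
theorem fe_of_geometric_pow_of_coeff_zero (hW : ∀ A : AbelianVariety K, A.weilRiemannHypothesis)
    {h : ℤ[X]} {g : ℕ} (hh : h.Monic) (hdeg : h.natDegree = 2 * g) {E : ℕ} (hE : 0 < E)
    {C : AbelianVariety K} (hC : C.IsFrobCharpoly (h ^ E)) (hc0 : h.coeff 0 = (Nat.card K : ℤ) ^ g) :
    ∀ i j, i + j = 2 * g → (Nat.card K : ℤ) ^ g * h.coeff j = (Nat.card K : ℤ) ^ i * h.coeff i :=
  (fe_iff_coeff_zero_of_rh Nat.card_pos hh hdeg (rh_of_geometric_pow hW hE hC)).2 hc0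

end Summit.RiemannHypothesis.RiemannHypothesis.Theorems.MotivicDoor.FunctionField
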